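import Literature.AlgebraicGeometry.Morphisms.CechH1LerayGluing
import Literature.AlgebraicGeometry.Morphisms.CechH2FibreDimOne
import Literature.AlgebraicGeometry.Morphisms.ProperPushforwardCoh
import Literature.AlgebraicGeometry.Morphisms.CechModuleUnit
import HarnessLib

/-!
# Čech gluing in degree one along a morphism: `Ȟ¹` of the whole space surjects onto `Ȟ¹` of one
# preimage piece when the mixed pieces are acyclic

[OURS · L W4.4 · support for the kill test `SurfaceTermination` stmt-ResolutionOfSingularities-16488,
the «(S)-step» of res-D-pv-045's programme `stub_pgNonincreasing` (PG-LERAY-NOTE §1 (S)); brick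
«GW-GLUE» of res-L0-w44-stub-4.] Fact-free cochain algebra over `Morphisms/CechH1LerayGluing` (the
degree-one Leray gluing `cechH1_glue_of_cechZ2_family_exact`, res-D-pv-039), `Morphisms/CechModuleH2`,
`Morphisms/CechModuleUnit` and `Morphisms/ProperPushforwardCoh`; the one named fact enters only as the
HYPOTHESIS `(hGW : GortzWedhorn2023_24_44_H2)` of §2/§4. NOT a statement of any manuscript under review
(Hironaka 2017). AI-written; AI review is weaker than expert review.

## Contents

* §1 (transport, definitional): for the structure sheaf `𝒪_X` as a sheaf of modules the module
  differential `d²` IS `cechD2` (`cechMD2_unit`), so `Ȟ²(𝒱, 𝒪_X) = 0` in the module sense gives the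
  hypothesis (H2V) «`Ž² = B̌²` on `𝒱`» of `cechH1_glue_of_cechZ2_family_exact`
  (`cechZ2_exact_of_subsingleton_cechMH2_unit`); for a morphism `π : Y → X` of `A`-schemes the
  `2`/`3`-cochains and `d²` of `π_* N` on `𝒰` are those of `N` on `π⁻¹𝒰`
  (`cechMD2_pushforwardEquiv_eq_zero_iff`), whence (H2V) for the PREIMAGE FAMILY `(π⁻¹ U_i)_i` on `Y`
  from `Ȟ²(𝒰, π_*𝒪_Y) = 0` on `X` (`cechZ2_exact_preimageFamily_of_subsingleton_cechMH2_pushforward`).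
* §2 (the `H²` input): for `g : B → Spec A` proper over a Noetherian local ring with fibres of
  dimension `≤ 1`, `ρ : Z → B` from a Noetherian scheme and a finite affine open cover `𝒲` of `B`,
  (H2V) holds for the family `(ρ⁻¹ W_a)_a` on `Z` — Görtz–Wedhorn II Cor. 24.44 (the tree's named fact
  `GortzWedhorn2023_24_44_H2`) applied to the quasi-coherent `ρ_*𝒪_Z`
  (`isAffineLocalizing_pushforward`, `IsAffineLocalizing.unit`) — `cechZ2_exact_preimageFamily_of_GW`.
* §3 (the surjection): if `𝒰` covers `X` and refines `𝒱`, (H2V) holds on `𝒱`, and for one index `a₀`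
  every MIXED piece has `Ȟ¹((U_i ∩ V_{a₀} ∩ V_b)_i, 𝒪_X) = 0` (`b ≠ a₀`), then the restriction
  `Ȟ¹(𝒰, 𝒪_X) → Ȟ¹((U_i ∩ V_{a₀})_i, 𝒪_X)` is SURJECTIVE: the family `(c, 0, …, 0)` is compatible and
  glues (`cechRefineH1_piece_surjective`); hence `length_A Ȟ¹((U_i ∩ V_{a₀})_i) ≤ length_A Ȟ¹(𝒰)`.
* §4 (the form used by `stub_pgNonincreasing`): §2 + §3 with `𝒱 := (ρ⁻¹ W_a)_a`
  (`cechRefineH1_preimage_piece_surjective_of_GW`, `length_cechH1_preimage_piece_le_of_GW`).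

The existence of the «good» cover `{W₀} ∪ {W_b ⊆ B ∖ S}` (OURS) is
`Summit.ResolutionOfSingularities.ResolutionOfSingularities.Theorems.SurfaceTermination.GenusDescent.exists_affineCover_eq_and_disjoint`
(`Summits/…/Theorems/HomologicalConductorSurfaceTerminationGoodCover.lean`).

Use (W4.4 kill test, (S)-step): `ρ : Z → B = Bl_{ca(T)}(Spec T)`, `W_{a₀} = D₊(x)`, the other
`W_b ⊆ B ∖ S` affine with `S` the (finitely many, closed) images of the singular points of the
normalised chart `Spec N`; the mixed pieces lie over affine opens of `Spec N` all of whose points are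
regular of dimension `≤ 2`, so their `Ȟ¹` vanishes (Lipman (1.2) pointwise + local-to-global,
res-D-pv-045 U2c); then `H := Ȟ¹(𝒰_Z) ↠ M := Ȟ¹((U_i ∩ ρ⁻¹D₊(x))_i)` and
`ℓ_{N_𝔮}(M_𝔮) ≤ ℓ_N(M) ≤ ℓ_T(M) ≤ ℓ_T(H)` — no finite-support argument is needed.

## References
* U. Görtz, T. Wedhorn, *Algebraic Geometry II*, Springer Spektrum (2023): Cor. 21.82, (21.16),
  Cor. 24.44. [GortzWedhorn2023]
* The Stacks Project, Tags 01ED (Čech complex, functoriality), 03F7, 01XD. [StacksProject]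
* M. Artin, *Lipman's proof of resolution of singularities for surfaces*, in: Arithmetic Geometry
  (Cornell–Silverman eds.), Springer (1986), Prop. (3.2)(i) (the printed `R¹` Leray sequence this
  replaces). [Artin1986]
-/

noncomputable section

-- `TopCat.Presheaf`/`TopCat.Sheaf` are not reducible (as in Mathlib's `AlgebraicGeometry/Modules`).
set_option backward.isDefEq.respectTransparency false

open CategoryTheory AlgebraicGeometry Limits TopologicalSpace Opposite
open Literature.AlgebraicGeometry.Modules

universe u v w

namespace Literature.AlgebraicGeometry.Morphisms

/-! ## §0. Triviality of `Ȟ¹` from `Ž¹ ≤ B̌¹` -/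

section Trivial

variable {A : Type u} [CommRing A] {X : Scheme.{u}} (f : X ⟶ Spec (.of A)) {ι : Type v}

/-- If every `1`-cocycle on the family `F` is a coboundary, every class of `Ȟ¹(F, 𝒪_X)` is `0`.
[cite: StacksProject, Tag 01ED (Cohomology, Section 20.9)] -/
theorem cechH1_eq_zero_of_cechZ1_le (F : ι → X.Opens) (h : cechZ1 f F ≤ cechB1 f F)
    (x : CechH1 f F) : x = 0 := by
  obtain ⟨z, rfl⟩ := CechH1.mk_surjective f F x
  exact (CechH1.mk_eq_zero_iff f F z).mpr (h z.2)

/-- The same for a family `F` that is (propositionally) EQUAL to a family `G` with `Ž¹ ≤ B̌¹` — used to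
pass between `(U_i ∩ V_a ∩ V_b)_i` and `(U_i ∩ V_b ∩ V_a)_i`. [cite: StacksProject, Tag 01ED (Cohomology, Section 20.9)] -/
theorem cechH1_eq_zero_of_eq_of_cechZ1_le {F G : ι → X.Opens} (hFG : F = G)
    (h : cechZ1 f G ≤ cechB1 f G) (x : CechH1 f F) : x = 0 := by
  subst hFG
  exact cechH1_eq_zero_of_cechZ1_le f F h x

/-- `Ž¹ ≤ B̌¹` transports along an equality of families. [cite: StacksProject, Tag 01ED (Cohomology, Section 20.9)] -/
theorem cechZ1_le_cechB1_of_eq {F G : ι → X.Opens} (hFG : F = G) (h : cechZ1 f G ≤ cechB1 f G) :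
    cechZ1 f F ≤ cechB1 f F := by
  subst hFG
  exact h

end Trivial

/-! ## §1. Degree-two transport: the unit module and push-forwards -/

section Unit

variable {A : Type u} [CommRing A] {X : Scheme.{u}} (f : X ⟶ Spec (.of A)) {ι : Type v}
  (U : ι → X.Opens)

/-- `d²` of `𝒪_X` as a sheaf of modules (`cechMD2` of `SheafOfModules.unit`) IS `cechD2`: definitionally.
[cite: StacksProject, Tag 01ED (Cohomology, Section 20.9)] -/
theorem cechMD2_unit (e : CechC2 f U) :
    cechMD2 f (SheafOfModules.unit X.ringCatSheaf) U e = cechD2 f U e := rfl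

/-- **(H2V) for `𝒪_X` from `Ȟ²(𝒰, 𝒪_X) = 0` in the module sense**: if `CechMH2` of the unit module on
`𝒰` is a subsingleton, every Čech `2`-cocycle of `𝒪_X` on `𝒰` is a `2`-coboundary (the hypothesis
`hH2` of `cechH1_glue_of_cechZ2_family_exact`). [cite: StacksProject, Tag 01ED (Cohomology, Section 20.9)] -/
theorem cechZ2_exact_of_subsingleton_cechMH2_unit
    (h : Subsingleton (CechMH2 f (SheafOfModules.unit X.ringCatSheaf) U)) :
    ∀ e : CechC2 f U, cechD2 f U e = 0 → ∃ c : CechC1 f U, cechD1 f U c = e := by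
  intro e he
  have hle := (subsingleton_cechMH2_iff f (SheafOfModules.unit X.ringCatSheaf) U).mp h
  have hz : e ∈ cechMZ2 f (SheafOfModules.unit X.ringCatSheaf) U := by
    rw [mem_cechMZ2_iff]
    exact he
  obtain ⟨c, hc⟩ := (mem_cechMB2_iff f (SheafOfModules.unit X.ringCatSheaf) U e).mp (hle hz)
  exact ⟨c, hc⟩

end Unit

section Pushforward

variable {A : Type u} [CommRing A] {X : Scheme.{u}} (f : X ⟶ Spec (.of A)) {ι : Type v}
  (U : ι → X.Opens) {Y : Scheme.{u}} (fY : Y ⟶ Spec (.of A)) (π : Y ⟶ X) (hπ : π ≫ f = fY)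
  (N : Y.Modules)

/-- The identification of `2`-cochains of `π_* N` on `𝒰` with those of `N` on `π⁻¹𝒰`
(`cechMC2PushforwardEquiv`) commutes with `d²`, componentwise (`Γ(V, π_* N) = Γ(π⁻¹V, N)` and the
restriction maps agree, definitionally). [cite: StacksProject, Tag 01ED (Cohomology, Section 20.9)] -/
theorem cechMD2_pushforwardEquiv_apply (e : CechMC2 f ((Scheme.Modules.pushforward π).obj N) U)
    (i j k l : ι) :
    cechMD2 fY N (preimageFamily π U) (cechMC2PushforwardEquiv f U fY π hπ N e) i j k l =
      (cechMD2 f ((Scheme.Modules.pushforward π).obj N) U e i j k l :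
        MSections fY N (π ⁻¹ᵁ (U i ⊓ U j ⊓ U k ⊓ U l))) := rfl

/-- Hence `d²` vanishes on a `2`-cochain of `π_* N` iff it vanishes on the corresponding `2`-cochain of
`N` on `π⁻¹𝒰`. [cite: StacksProject, Tag 01ED (Cohomology, Section 20.9)] -/
theorem cechMD2_pushforwardEquiv_eq_zero_iff (e : CechMC2 f ((Scheme.Modules.pushforward π).obj N) U) :
    cechMD2 fY N (preimageFamily π U) (cechMC2PushforwardEquiv f U fY π hπ N e) = 0 ↔
      cechMD2 f ((Scheme.Modules.pushforward π).obj N) U e = 0 := by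
  constructor
  · intro h
    funext i j k l
    have hc := congrFun (congrFun (congrFun (congrFun h i) j) k) l
    rw [cechMD2_pushforwardEquiv_apply] at hc
    exact hc
  · intro h
    funext i j k l
    rw [cechMD2_pushforwardEquiv_apply, h]

/-- `2`-cocycles correspond under `cechMC2PushforwardEquiv`. [cite: StacksProject, Tag 01ED (Cohomology, Section 20.9)] -/
theorem mem_cechMZ2_pushforwardEquiv_iff (e : CechMC2 f ((Scheme.Modules.pushforward π).obj N) U) :
    cechMC2PushforwardEquiv f U fY π hπ N e ∈ cechMZ2 fY N (preimageFamily π U) ↔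
      e ∈ cechMZ2 f ((Scheme.Modules.pushforward π).obj N) U := by
  rw [mem_cechMZ2_iff, mem_cechMZ2_iff, cechMD2_pushforwardEquiv_eq_zero_iff]

/-- `2`-coboundaries correspond under `cechMC2PushforwardEquiv`. [cite: StacksProject, Tag 01ED (Cohomology, Section 20.9)] -/
theorem mem_cechMB2_pushforwardEquiv_iff (e : CechMC2 f ((Scheme.Modules.pushforward π).obj N) U) :
    cechMC2PushforwardEquiv f U fY π hπ N e ∈ cechMB2 fY N (preimageFamily π U) ↔
      e ∈ cechMB2 f ((Scheme.Modules.pushforward π).obj N) U := by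
  rw [mem_cechMB2_iff, mem_cechMB2_iff]
  constructor
  · rintro ⟨c, hc⟩
    refine ⟨(cechMC1PushforwardEquiv f U fY π hπ N).symm c, ?_⟩
    apply (cechMC2PushforwardEquiv f U fY π hπ N).injective
    rw [← cechMD1_pushforwardEquiv, LinearEquiv.apply_symm_apply, hc]
  · rintro ⟨c, rfl⟩
    exact ⟨cechMC1PushforwardEquiv f U fY π hπ N c, cechMD1_pushforwardEquiv f U fY π hπ N c⟩

include hπ in
/-- **`Ȟ²(𝒰, π_* N) = 0 ⟹ Ȟ²(π⁻¹𝒰, N) = 0`** (same cochains, same differentials).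
[cite: StacksProject, Tag 01ED (Cohomology, Section 20.9)] -/
theorem cechMZ2_le_cechMB2_preimageFamily_of_pushforward
    (h : Subsingleton (CechMH2 f ((Scheme.Modules.pushforward π).obj N) U)) :
    cechMZ2 fY N (preimageFamily π U) ≤ cechMB2 fY N (preimageFamily π U) := by
  intro e he
  obtain ⟨e', rfl⟩ := (cechMC2PushforwardEquiv f U fY π hπ N).surjective e
  rw [mem_cechMZ2_pushforwardEquiv_iff] at he
  rw [mem_cechMB2_pushforwardEquiv_iff]
  exact (subsingleton_cechMH2_iff f _ U).mp h he

include hπ in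
/-- **(H2V) for the preimage family**: if `Ȟ²(𝒰, π_*𝒪_Y) = 0` on `X`, every Čech `2`-cocycle of `𝒪_Y`
on the family `(π⁻¹ U_i)_i` is a `2`-coboundary. [cite: StacksProject, Tag 01ED (Cohomology, Section 20.9)] -/
theorem cechZ2_exact_preimageFamily_of_subsingleton_cechMH2_pushforward
    (h : Subsingleton (CechMH2 f
      ((Scheme.Modules.pushforward π).obj (SheafOfModules.unit Y.ringCatSheaf)) U)) :
    ∀ e : CechC2 fY (preimageFamily π U), cechD2 fY (preimageFamily π U) e = 0 →
      ∃ c : CechC1 fY (preimageFamily π U), cechD1 fY (preimageFamily π U) c = e := by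
  have hle := cechMZ2_le_cechMB2_preimageFamily_of_pushforward f U fY π hπ
    (SheafOfModules.unit Y.ringCatSheaf) h
  intro e he
  have hz : e ∈ cechMZ2 fY (SheafOfModules.unit Y.ringCatSheaf) (preimageFamily π U) := by
    rw [mem_cechMZ2_iff]
    exact he
  obtain ⟨c, hc⟩ := (mem_cechMB2_iff fY (SheafOfModules.unit Y.ringCatSheaf) _ e).mp (hle hz)
  exact ⟨c, hc⟩

end Pushforward

/-! ## §2. The `H²` input from Görtz–Wedhorn II Cor. 24.44 -/

section GW

variable {A : Type u} [CommRing A] [IsNoetherianRing A] [IsLocalRing A] {B Z : Scheme.{u}}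

/-- **(H2V) for the pieces `ρ⁻¹W_a` over a proper `B` with fibres of dimension `≤ 1`** (modulo the
named fact `GortzWedhorn2023_24_44_H2`): for `g : B → Spec A` proper, `A` Noetherian local, all fibres
of topological Krull dimension `≤ 1`, `ρ : Z → B` with `Z` Noetherian (so that `ρ_*𝒪_Z` is
quasi-coherent = affine-localizing, Hartshorne II 5.8 (c)), and a finite affine open cover `𝒲` of `B`,
every Čech `2`-cocycle of `𝒪_Z` on `(ρ⁻¹W_a)_a` is a `2`-coboundary — since
`Č•((ρ⁻¹W_a), 𝒪_Z) = Č•(𝒲, ρ_*𝒪_Z)` and `Ȟ²(𝒲, ρ_*𝒪_Z) = 0`. [cite: GortzWedhorn2023, Cor. 24.44] -/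
theorem cechZ2_exact_preimageFamily_of_GW (hGW : GortzWedhorn2023_24_44_H2.{u})
    (g : B ⟶ Spec (.of A)) [IsProper g]
    (hfib : ∀ y : Spec (.of A), topologicalKrullDim (g.fiber y) ≤ 1)
    (ρ : Z ⟶ B) [NoetherianSpace Z] (f : Z ⟶ Spec (.of A)) (hf : ρ ≫ g = f)
    {α : Type u} [Finite α] (W : α → B.Opens) (hW : ∀ a, IsAffineOpen (W a)) (hcov : ⨆ a, W a = ⊤) :
    ∀ e : CechC2 f (preimageFamily ρ W), cechD2 f (preimageFamily ρ W) e = 0 →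
      ∃ c : CechC1 f (preimageFamily ρ W), cechD1 f (preimageFamily ρ W) c = e :=
  cechZ2_exact_preimageFamily_of_subsingleton_cechMH2_pushforward g W f ρ hf
    (hGW A B g hfib _ (isAffineLocalizing_pushforward ρ IsAffineLocalizing.unit) α W hW hcov)

end GW

/-! ## §3. Surjectivity onto one piece when the mixed pieces are acyclic -/

section Piece

variable {A : Type u} [CommRing A] {X : Scheme.{u}} (f : X ⟶ Spec (.of A))
  {ι : Type v} {α : Type w} (U : ι → X.Opens) (V : α → X.Opens)

/-- **`Ȟ¹(𝒰) ↠ Ȟ¹((U_i ∩ V_{a₀})_i)` when the mixed pieces are acyclic.** Let `𝒰` cover `X` and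
refine `𝒱` along `r`, assume (H2V) on `𝒱`, fix `a₀`, and assume `Ȟ¹((U_i ∩ V_{a₀} ∩ V_b)_i, 𝒪_X) = 0`
(`Ž¹ ≤ B̌¹`) for every `b ≠ a₀`. Then every class on the piece `V_{a₀}` is the restriction of a class on
`𝒰`: the family `(c, 0, …, 0)` is compatible (its comparisons live in the trivial mixed groups, or are
`0 = 0`, or are literally equal on the diagonal) and glues by `cechH1_glue_of_cechZ2_family_exact`.
[cite: GortzWedhorn2023, Cor. 21.82 (p. 265)] -/
theorem cechRefineH1_piece_surjective (r : ι → α) (hr : ∀ i, U i ≤ V (r i)) (hU : ⨆ i, U i = ⊤)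
    (hH2 : ∀ g : CechC2 f V, cechD2 f V g = 0 → ∃ h : CechC1 f V, cechD1 f V h = g)
    (a₀ : α)
    (hvan : ∀ b, b ≠ a₀ →
      cechZ1 f (fun i => U i ⊓ V a₀ ⊓ V b) ≤ cechB1 f (fun i => U i ⊓ V a₀ ⊓ V b)) :
    Function.Surjective (cechRefineH1 f U (fun i => U i ⊓ V a₀) id (fun _ => inf_le_left)) := by
  classical
  intro c₀
  -- the family `(c₀, 0, …, 0)`
  obtain ⟨c, hc₀, hcb⟩ :
      ∃ c : ∀ a, CechH1 f (fun i => U i ⊓ V a), c a₀ = c₀ ∧ ∀ b, b ≠ a₀ → c b = 0 :=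
    ⟨Function.update (fun _ => 0) a₀ c₀, by rw [Function.update_self],
      fun b hb => by rw [Function.update_of_ne hb]⟩
  have hcompat : ∀ a b,
      cechRefineH1 f (fun i => U i ⊓ V a) (fun i => U i ⊓ V a ⊓ V b) id (fun _ => inf_le_left) (c a) =
        cechRefineH1 f (fun i => U i ⊓ V b) (fun i => U i ⊓ V a ⊓ V b) id
          (fun _ => le_inf (inf_le_left.trans inf_le_left) inf_le_right) (c b) := by
    intro a b
    by_cases ha : a = a₀
    · subst ha
      by_cases hb : b = a
      · subst hb
        rfl
      · rw [hcb b hb, map_zero]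
        exact cechH1_eq_zero_of_cechZ1_le f _ (hvan b hb) _
    · by_cases hb : b = a₀
      · subst hb
        rw [hcb a ha, map_zero]
        symm
        refine cechH1_eq_zero_of_eq_of_cechZ1_le f ?_ (hvan a ha) _
        funext i
        exact inf_right_comm (U i) (V a) (V b)
      · rw [hcb a ha, hcb b hb, map_zero, map_zero]
  obtain ⟨cbar, hcbar⟩ := cechH1_glue_of_cechZ2_family_exact f U V r hr hU hH2 c hcompat
  exact ⟨cbar, (hcbar a₀).trans hc₀⟩

/-- Hence **`length_A Ȟ¹((U_i ∩ V_{a₀})_i, 𝒪_X) ≤ length_A Ȟ¹(𝒰, 𝒪_X)`** (lengths in `ℕ∞`).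
[cite: GortzWedhorn2023, Cor. 21.82 (p. 265)] -/
theorem length_cechH1_piece_le (r : ι → α) (hr : ∀ i, U i ≤ V (r i)) (hU : ⨆ i, U i = ⊤)
    (hH2 : ∀ g : CechC2 f V, cechD2 f V g = 0 → ∃ h : CechC1 f V, cechD1 f V h = g)
    (a₀ : α)
    (hvan : ∀ b, b ≠ a₀ →
      cechZ1 f (fun i => U i ⊓ V a₀ ⊓ V b) ≤ cechB1 f (fun i => U i ⊓ V a₀ ⊓ V b)) :
    Module.length A (CechH1 f (fun i => U i ⊓ V a₀)) ≤ Module.length A (CechH1 f U) :=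
  Module.length_le_of_surjective _ (cechRefineH1_piece_surjective f U V r hr hU hH2 a₀ hvan)

end Piece

/-! ## §4. The form used along a morphism to a proper `B` with curve fibres -/

section Preimage

variable {A : Type u} [CommRing A] [IsNoetherianRing A] [IsLocalRing A] {B Z : Scheme.{u}}

/-- **The (S)-step surjection.** `g : B → Spec A` proper, `A` Noetherian local, fibres of dimension
`≤ 1`; `ρ : Z → B` with `Z` Noetherian, `f = ρ ≫ g`; `𝒲` a finite affine open cover of `B`; `𝒰` an open
cover of `Z` refining `(ρ⁻¹W_a)_a`; `a₀` an index such that every mixed piece has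
`Ȟ¹((U_i ∩ ρ⁻¹W_{a₀} ∩ ρ⁻¹W_b)_i, 𝒪_Z) = 0` (`b ≠ a₀`). Then, modulo `GortzWedhorn2023_24_44_H2`,
`Ȟ¹(𝒰, 𝒪_Z) → Ȟ¹((U_i ∩ ρ⁻¹W_{a₀})_i, 𝒪_Z)` is surjective. [cite: GortzWedhorn2023, Cor. 21.82 (p. 265), Cor. 24.44] -/
theorem cechRefineH1_preimage_piece_surjective_of_GW (hGW : GortzWedhorn2023_24_44_H2.{u})
    (g : B ⟶ Spec (.of A)) [IsProper g]
    (hfib : ∀ y : Spec (.of A), topologicalKrullDim (g.fiber y) ≤ 1)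
    (ρ : Z ⟶ B) [NoetherianSpace Z] (f : Z ⟶ Spec (.of A)) (hf : ρ ≫ g = f)
    {α : Type u} [Finite α] (W : α → B.Opens) (hW : ∀ a, IsAffineOpen (W a)) (hcov : ⨆ a, W a = ⊤)
    {ι : Type v} (U : ι → Z.Opens) (r : ι → α) (hr : ∀ i, U i ≤ ρ ⁻¹ᵁ W (r i)) (hU : ⨆ i, U i = ⊤)
    (a₀ : α)
    (hvan : ∀ b, b ≠ a₀ →
      cechZ1 f (fun i => U i ⊓ ρ ⁻¹ᵁ W a₀ ⊓ ρ ⁻¹ᵁ W b) ≤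
        cechB1 f (fun i => U i ⊓ ρ ⁻¹ᵁ W a₀ ⊓ ρ ⁻¹ᵁ W b)) :
    Function.Surjective
      (cechRefineH1 f U (fun i => U i ⊓ ρ ⁻¹ᵁ W a₀) id (fun _ => inf_le_left)) :=
  cechRefineH1_piece_surjective f U (preimageFamily ρ W) r hr hU
    (cechZ2_exact_preimageFamily_of_GW hGW g hfib ρ f hf W hW hcov) a₀ hvan

/-- **The (S)-step length inequality**: under the same hypotheses,
`length_A Ȟ¹((U_i ∩ ρ⁻¹W_{a₀})_i, 𝒪_Z) ≤ length_A Ȟ¹(𝒰, 𝒪_Z)`. [cite: GortzWedhorn2023, Cor. 21.82 (p. 265), Cor. 24.44] -/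
theorem length_cechH1_preimage_piece_le_of_GW (hGW : GortzWedhorn2023_24_44_H2.{u})
    (g : B ⟶ Spec (.of A)) [IsProper g]
    (hfib : ∀ y : Spec (.of A), topologicalKrullDim (g.fiber y) ≤ 1)
    (ρ : Z ⟶ B) [NoetherianSpace Z] (f : Z ⟶ Spec (.of A)) (hf : ρ ≫ g = f)
    {α : Type u} [Finite α] (W : α → B.Opens) (hW : ∀ a, IsAffineOpen (W a)) (hcov : ⨆ a, W a = ⊤)
    {ι : Type v} (U : ι → Z.Opens) (r : ι → α) (hr : ∀ i, U i ≤ ρ ⁻¹ᵁ W (r i)) (hU : ⨆ i, U i = ⊤)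
    (a₀ : α)
    (hvan : ∀ b, b ≠ a₀ →
      cechZ1 f (fun i => U i ⊓ ρ ⁻¹ᵁ W a₀ ⊓ ρ ⁻¹ᵁ W b) ≤
        cechB1 f (fun i => U i ⊓ ρ ⁻¹ᵁ W a₀ ⊓ ρ ⁻¹ᵁ W b)) :
    Module.length A (CechH1 f (fun i => U i ⊓ ρ ⁻¹ᵁ W a₀)) ≤ Module.length A (CechH1 f U) :=
  Module.length_le_of_surjective _
    (cechRefineH1_preimage_piece_surjective_of_GW hGW g hfib ρ f hf W hW hcov U r hr hU a₀ hvan)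

/-- **The (S)-step, with the mixed pieces written as preimages of the affine overlaps
`W_{a₀} ∩ W_b`** (`ρ⁻¹(W_{a₀} ∩ W_b) = ρ⁻¹W_{a₀} ∩ ρ⁻¹W_b` definitionally; `inf_assoc`): if
`Ȟ¹((U_i ∩ ρ⁻¹(W_{a₀} ∩ W_b))_i, 𝒪_Z) = 0` for all `b ≠ a₀`, then
`Ȟ¹(𝒰, 𝒪_Z) ↠ Ȟ¹((U_i ∩ ρ⁻¹W_{a₀})_i, 𝒪_Z)` and
`length_A Ȟ¹((U_i ∩ ρ⁻¹W_{a₀})_i, 𝒪_Z) ≤ length_A Ȟ¹(𝒰, 𝒪_Z)`, modulo `GortzWedhorn2023_24_44_H2`.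
[cite: GortzWedhorn2023, Cor. 21.82 (p. 265), Cor. 24.44] -/
theorem cechRefineH1_preimage_piece_surjective_of_GW' (hGW : GortzWedhorn2023_24_44_H2.{u})
    (g : B ⟶ Spec (.of A)) [IsProper g]
    (hfib : ∀ y : Spec (.of A), topologicalKrullDim (g.fiber y) ≤ 1)
    (ρ : Z ⟶ B) [NoetherianSpace Z] (f : Z ⟶ Spec (.of A)) (hf : ρ ≫ g = f)
    {α : Type u} [Finite α] (W : α → B.Opens) (hW : ∀ a, IsAffineOpen (W a)) (hcov : ⨆ a, W a = ⊤)
    {ι : Type v} (U : ι → Z.Opens) (r : ι → α) (hr : ∀ i, U i ≤ ρ ⁻¹ᵁ W (r i)) (hU : ⨆ i, U i = ⊤)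
    (a₀ : α)
    (hvan : ∀ b, b ≠ a₀ →
      cechZ1 f (fun i => U i ⊓ ρ ⁻¹ᵁ (W a₀ ⊓ W b)) ≤ cechB1 f (fun i => U i ⊓ ρ ⁻¹ᵁ (W a₀ ⊓ W b))) :
    Function.Surjective
        (cechRefineH1 f U (fun i => U i ⊓ ρ ⁻¹ᵁ W a₀) id (fun _ => inf_le_left)) ∧
      Module.length A (CechH1 f (fun i => U i ⊓ ρ ⁻¹ᵁ W a₀)) ≤ Module.length A (CechH1 f U) := by
  have hvan' : ∀ b, b ≠ a₀ →
      cechZ1 f (fun i => U i ⊓ ρ ⁻¹ᵁ W a₀ ⊓ ρ ⁻¹ᵁ W b) ≤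
        cechB1 f (fun i => U i ⊓ ρ ⁻¹ᵁ W a₀ ⊓ ρ ⁻¹ᵁ W b) := fun b hb =>
    cechZ1_le_cechB1_of_eq f (funext fun i => inf_assoc (U i) (ρ ⁻¹ᵁ W a₀) (ρ ⁻¹ᵁ W b)) (hvan b hb)
  exact ⟨cechRefineH1_preimage_piece_surjective_of_GW hGW g hfib ρ f hf W hW hcov U r hr hU a₀ hvan',
    length_cechH1_preimage_piece_le_of_GW hGW g hfib ρ f hf W hW hcov U r hr hU a₀ hvan'⟩

end Preimage

end Literature.AlgebraicGeometry.Morphisms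

end
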